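import Summits.SmoothPoincare4.SmoothPoincare4.Theses.WeakReductionDescent
import Literature.Topology.FourManifolds.SphereTrisectionsSectors
import Literature.Topology.FourManifolds.TrisectionFunctorGKNaturality

/-!
# Birth attack on crux `WeakReductionDescent.WeakReductionReduces` — findings: SPC4-shielded (S → C proved), a kill = an exotic S⁴, no cheap kill, faithful to AZ25

Seat refuter-rattack-stmt-SmoothPoincare4-17834-0, 2026-08-17.  Route
`route-SmoothPoincare4-WeakReductionDescent`, crux rank 3 (sibling crux `MinimalWeaklyReducible`).
Written against rev 1 of the route file (route-repair 2026-08-17T05:02:18Z: items restated over the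
Statement's bare binders `M` + `e : M ≃ₕ S⁴`; item stmt-SmoothPoincare4-17834 retired → restated as
stmt-SmoothPoincare4-17908, SAME decl name; the rev-0 form over `HomotopySphere 4` was checked the
same way, see the item evidence of stmt-SmoothPoincare4-17834).

Kernel-checked findings of the one-cycle attack (this file is sorry-free):

* `not_minimal_of_spc4` — under `SmoothPoincare4` no Gay–Kirby trisection of genus `≥ 1` of a
  smooth homotopy 4-sphere is of minimal genus: the round `S⁴` carries GK's genus-`0` trisection
  (tree, PROVED: `Literature.Topology.FourManifolds.sphere_genusZero_gkTrisection_holds`),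
  transported to `M` along the diffeomorphism that SPC4 provides (tree, PROVED:
  `Literature.Topology.FourManifolds.IsGKTrisection.image_diffeomorph'`).
* `weakReductionReduces_of_spc4 : SmoothPoincare4 → WeakReductionReduces` — the crux is
  **SPC4-shielded** (restates-summit probe `S → C` holds, by VACUITY of the hypotheses
  `IsGKTrisection … g … ∧ 4 ≤ g ∧ minimal`); likewise `minimalWeaklyReducible_of_spc4` for the sibling.
* `not_spc4_of_not_weakReductionReduces`, `exotic_of_not_weakReductionReduces` — the KILL
  CRITERION, formally: a refutation of the crux is an exotic 4-sphere, namely a smooth homotopy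
  4-sphere carrying a (weakly reducible, irreducible) minimal GK-trisection of genus `≥ 4`; such an
  `M` admits no diffeomorphism to `S⁴`.  No refutation short of `¬ SmoothPoincare4` exists.
* The converse probe `C → S` (`WeakReductionReduces → SmoothPoincare4`) is NOT available by
  `exact? / aesop / simp` (Scratch probes, seat notes): the crux is one conjunct of the route's
  strengthening `MinimalWeaklyReducible ∧ WeakReductionReduces`, silent on strongly irreducible
  minimal trisections, and even the conjunction reaches `SmoothPoincare4` only through the supports
  `ReducibleSplits`, `GenusThreeBase`, `LowGenusBase`, `TrisectionsExist`, `SphereSumSphere`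
  (deciding theorem `closes`).  Through the tree, `S → K1 ∧ K2` (here) and `K1 ∧ K2 ∧ supports → S`
  (`closes`): the pair of cruxes is SPC4 split into the weakly-reducible / reduction cases.

Faithfulness (read against arXiv:2503.04607 p. 2 and p. 6, Remark 2.5): "T is weakly reducible if
there are disjoint non-separating curves c and c′ such that c bounds a disk in one of the three
handlebodies, and c′ bounds a disk in the other two"; "reducible if there exists a curve c in Σ which
is a compressing curve for all three of Hα, Hβ, Hγ" — the `let`-bound `WeaklyReducible` / `Reducible`
of the decl transcribe exactly this (compressing = essential in `F` + bounds a properly embedded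
disc), over the corrected, inhabited predicate `IsGKTrisection`.  Compactness, connectedness and
orientability of `M` are not assumed but follow from `e : M ≃ₕ S⁴` (tree) and from
`IsGKTrisection.compactSpace`.
-/

open scoped Manifold ContDiff Topology ContinuousMap
open Set

namespace Summit.SmoothPoincare4.SmoothPoincare4.Cruxes.WeakReductionReduces.BirthAttack

open Literature.Topology.FourManifolds
open Summit.SmoothPoincare4.SmoothPoincare4.Theses.WeakReductionDescent

/-- The round `4`-sphere of Mathlib. -/
local notation "𝕊⁴" => (Metric.sphere (0 : EuclideanSpace ℝ (Fin 5)) 1)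

variable {M : Type} [TopologicalSpace M] [ChartedSpace (EuclideanSpace ℝ (Fin 4)) M]
  [IsManifold (𝓡 4) ∞ M]

/-- A diffeomorphism to the round sphere pulls GK's genus-`0` trisection of `S⁴` back to a
genus-`0` GK-trisection of `M`. [folklore] -/
theorem exists_gkTrisection_genus_zero_of_diffeomorph (Φ : M ≃ₘ⟮𝓡 4, 𝓡 4⟯ 𝕊⁴) :
    ∃ T : Fin 3 → Set M, IsGKTrisection M 0 (fun _ => 0) T := by
  obtain ⟨S₀, hS₀⟩ := sphere_genusZero_gkTrisection_holds
  exact ⟨fun i => Φ.symm '' S₀ i, hS₀.isGKTrisection.image_diffeomorph' Φ.symm⟩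

/-- If `M` is diffeomorphic to `S⁴`, no GK-trisection of `M` of genus `≥ 1` is of minimal genus.
[folklore] -/
theorem not_minimal_of_diffeomorph (Φ : M ≃ₘ⟮𝓡 4, 𝓡 4⟯ 𝕊⁴) {g : ℕ} (hg : 1 ≤ g) :
    ¬ ∀ (g' : ℕ) (k' : Fin 3 → ℕ) (T' : Fin 3 → Set M), IsGKTrisection M g' k' T' → g ≤ g' := by
  intro hmin
  obtain ⟨T₀, hT₀⟩ := exists_gkTrisection_genus_zero_of_diffeomorph Φ
  have := hmin 0 (fun _ => 0) T₀ hT₀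
  omega

/-- **Vacuity under the summit.** Under `SmoothPoincare4` no GK-trisection of genus `≥ 1` of a
smooth homotopy 4-sphere (bare binders + `e : M ≃ₕ S⁴`) is of minimal genus. [folklore] -/
theorem not_minimal_of_spc4 (h : _root_.SmoothPoincare4) {M : Type} [TopologicalSpace M] [T2Space M]
    [SecondCountableTopology M] [ChartedSpace (EuclideanSpace ℝ (Fin 4)) M] [IsManifold (𝓡 4) ∞ M]
    (e : M ≃ₕ 𝕊⁴) {g : ℕ} (hg : 1 ≤ g) :
    ¬ ∀ (g' : ℕ) (k' : Fin 3 → ℕ) (T' : Fin 3 → Set M), IsGKTrisection M g' k' T' → g ≤ g' := by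
  obtain ⟨Φ⟩ := h M ‹_› ‹_› e
  exact not_minimal_of_diffeomorph Φ hg

/-- **The crux is implied by the summit** (`S → C`, shield): `SmoothPoincare4 → WeakReductionReduces`,
by vacuity of the hypotheses `4 ≤ g ∧ minimal`. [folklore] -/
theorem weakReductionReduces_of_spc4 (h : _root_.SmoothPoincare4) : WeakReductionReduces := by
  intro M _ _ _ _ _ e g k T _hT hg hmin _hwr
  exact absurd hmin (not_minimal_of_spc4 h e (by omega))

/-- The same shield for the sibling crux: `SmoothPoincare4 → MinimalWeaklyReducible`. [folklore] -/
theorem minimalWeaklyReducible_of_spc4 (h : _root_.SmoothPoincare4) : MinimalWeaklyReducible := by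
  intro M _ _ _ _ _ e g k T _hT hg hmin
  exact absurd hmin (not_minimal_of_spc4 h e (by omega))

/-- **Kill criterion, formally**: a refutation of the crux refutes the summit. [folklore] -/
theorem not_spc4_of_not_weakReductionReduces (h : ¬ WeakReductionReduces) :
    ¬ _root_.SmoothPoincare4 :=
  fun hs => h (weakReductionReduces_of_spc4 hs)

/-- **What a kill would be**: a smooth homotopy 4-sphere `M` with a minimal GK-trisection of genus
`≥ 4` (weakly reducible, not reducible) admitting NO diffeomorphism to the round `S⁴` — an exotic
4-sphere of trisection genus `≥ 4`. [folklore] -/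
theorem exotic_of_not_weakReductionReduces (h : ¬ WeakReductionReduces) :
    ∃ (M : Type) (_ : TopologicalSpace M) (_ : T2Space M) (_ : SecondCountableTopology M)
      (_ : ChartedSpace (EuclideanSpace ℝ (Fin 4)) M) (_ : IsManifold (𝓡 4) ∞ M),
      Nonempty (M ≃ₕ 𝕊⁴) ∧
      (∃ (g : ℕ) (k : Fin 3 → ℕ) (T : Fin 3 → Set M), IsGKTrisection M g k T ∧ 4 ≤ g ∧
        ∀ (g' : ℕ) (k' : Fin 3 → ℕ) (T' : Fin 3 → Set M), IsGKTrisection M g' k' T' → g ≤ g') ∧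
      IsEmpty (M ≃ₘ⟮𝓡 4, 𝓡 4⟯ 𝕊⁴) := by
  unfold WeakReductionReduces at h
  push Not at h
  obtain ⟨M, _, _, _, _, _, e, g, k, T, hT, hg, hmin, -, -⟩ := h
  have h1 : 1 ≤ g := le_trans (by norm_num) hg
  exact ⟨M, ‹_›, ‹_›, ‹_›, ‹_›, ‹_›, ⟨e⟩, ⟨g, k, T, hT, hg, hmin⟩,
    ⟨fun Φ => not_minimal_of_diffeomorph Φ h1 hmin⟩⟩

end Summit.SmoothPoincare4.SmoothPoincare4.Cruxes.WeakReductionReduces.BirthAttack
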